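import Summits.QuantumFields.YangMills.Theorems.SwapVirialDeficitBlowUpPeriodicTwoScaleStructure
import Summits.QuantumFields.YangMills.Theorems.SwapVirialDeficitTwoScaleCalculusParam
import HarnessLib

/-!
# The PERIODIC massive-mode rung, brick PM-IIb″: `Φ` is JOINTLY continuous in `(u, s, a₀, w', y)`; the pointwise two-scale limit of the fibre condition
# with a MOVING hub
# (free-hands support of ⟨stmt-QuantumFields-24196⟩ `SwapVirialDeficit.ToronSoftnessSharp`; LEAD memo `sfw-p2-g96-memo-24196-PM-design.md` §2;
# consumes ✓PM-IIb `twoScaleDeficit_eq_pow_four_mul_sq`/`twoScaleDeficit_le_iff`, ✓`TwoScaleCalculus.continuousOn_twoScaleRemainder_slice`)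

The log-squeeze extraction (PM-III) needs the two-scale limit locally uniformly in the hub coordinate `a₀`, so the dominated-convergence step (PM-IId) lets
`(u, s, a₀)` move together.  This file packages the joint data:
* `sliceGood L` (open) — `a₀ ≠ 0`, leader and follower real parts `≠ 0`; `jointDeficit` = ✓`twoScaleDeficit` as one function on `TwoScaleParam L`, `C^∞` on
  `ℝ × ℝ × sliceGood`;
* ★ `twoScalePhi L u s a₀ w' y := twoScaleRemainder (G(·,·;a₀,w',y)) u s` and ★★★ `continuousOn_twoScalePhi` — `Φ` is continuous on `ℝ × ℝ × sliceGood` JOINTLY;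
  `twoScaleDeficit_eq_pow_four_mul_sq_phi` (`G = u⁴s²Φ`), `twoScaleDeficit_le_iff_phi`;
* ★★ `eventually_twoScaleDeficit_le_iff` — at a non-degenerate point with `0 < y₀ᶠ` and `Φ(0,0;a₀,w',y) ≠ 1`: as `(u, s, a') → (0, 0, a₀)` through `u, s ≠ 0`,
  `G(u, s; a', w', y) ≤ (u²s)²  ⟺  Φ(0, 0; a₀, w', y) < 1` eventually — the pointwise input of dominated convergence for ✓`twoScaleVolume`
  (periodic analogue of ✓`BlowUp.eventually_mem_iff_blowUpLimit`).
What remains for PM: the null level `{Φ(0,0;a₀,·) = 1}` (or the good-threshold variant), the `(u,s)`-free dominator, the DCT itself, PM-III (memo §2–§3).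
HONEST LABEL: finite-dimensional calculus (plan-level fixed-`L` rung of a DRAFT line); PM, ⟨24196⟩, ⟨24194⟩, ⟨24197⟩, ⟨24497⟩ NOT proved; own crux ⟨22884⟩ OPEN
(blocked-on ⟨19935⟩); the Yang–Mills mass gap is NOT proved; no summit is proved by a line.
LEAD seat ym-line-sfw-p2 g96 (cell ym-idea-1, free hands), `--supports stmt-QuantumFields-24196`.  Defs `sliceGood`, `jointDeficit`, `twoScalePhi`; standard axioms, 0 `sorry`.
References: [cite: Luscher1983, §2]; [cite: GonzalezarroyoAltes1988]; [folklore].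
-/

set_option autoImplicit false

noncomputable section

open Quaternion Set Filter Topology
open scoped Quaternion BigOperators ContDiff
open Literature.MathematicalPhysics.QuantumLattice
open Literature.MathematicalPhysics.QuantumFieldTheory hiding SU2
open Summit.QuantumFields.YangMills.Theorems.SwapTwistDeficit.ToronLog

namespace Summit.QuantumFields.YangMills.Theorems.SwapVirialDeficit.BlowUpRing

open Summit.QuantumFields.YangMills.Theorems.FemtoTransferGap
open Summit.QuantumFields.YangMills.Theorems.FemtoTransferGap.TT

variable {L : ℕ} [NeZero L]

/-! ## §E Joint continuity of `Φ` in `(u, s, a₀, w', y)` and the pointwise two-scale limit of the fibre condition -/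

section Joint

open Summit.QuantumFields.YangMills.Theorems.SwapVirialDeficit.TwoScaleCalculus

variable (L) in
/-- **The non-degenerate slice parameters** `(a₀, w', y)`: `a₀ ≠ 0`, all leader and follower real parts non-zero (an intersection of open preimages). [folklore] -/
def sliceGood : Set (ℝ × ((ℍ × ℍ) × ℍ) × (Fol L → ℍ)) :=
  {z | z.1 ≠ 0} ∩ {z | z.2.1.1.1.re ≠ 0} ∩ {z | z.2.1.1.2.re ≠ 0} ∩ {z | z.2.1.2.re ≠ 0} ∩ ⋂ i : Fol L, {z | (z.2.2 i).re ≠ 0}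

omit [NeZero L] in
/-- Membership in `sliceGood` from the five non-degeneracy conditions. [folklore] -/
theorem mem_sliceGood {a₀ : ℝ} {w' : (ℍ × ℍ) × ℍ} {y : Fol L → ℍ} (ha : a₀ ≠ 0) (hx : w'.1.1.re ≠ 0) (hy' : w'.1.2.re ≠ 0) (hz : w'.2.re ≠ 0)
    (hf : ∀ i, (y i).re ≠ 0) : ((a₀, w', y) : ℝ × ((ℍ × ℍ) × ℍ) × (Fol L → ℍ)) ∈ sliceGood L :=
  ⟨⟨⟨⟨ha, hx⟩, hy'⟩, hz⟩, Set.mem_iInter.2 fun i => hf i⟩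

/-- `sliceGood` is open. [folklore] -/
theorem isOpen_sliceGood : IsOpen (sliceGood L) := by
  have hre : Continuous fun q : ℍ => q.re := Quaternion.continuous_re
  unfold sliceGood
  refine ((((isOpen_ne.preimage continuous_fst).inter ?_).inter ?_).inter ?_).inter ?_
  · exact isOpen_ne.preimage (hre.comp (continuous_fst.comp (continuous_fst.comp (continuous_fst.comp continuous_snd))))
  · exact isOpen_ne.preimage (hre.comp (continuous_snd.comp (continuous_fst.comp (continuous_fst.comp continuous_snd))))
  · exact isOpen_ne.preimage (hre.comp (continuous_snd.comp (continuous_fst.comp continuous_snd)))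
  · exact isOpen_iInter_of_finite fun i => isOpen_ne.preimage (hre.comp ((continuous_apply i).comp (continuous_snd.comp continuous_snd)))

variable (L) in
/-- The two-scale deficit as ONE function on `TwoScaleParam L = ℝ × ℝ × (ℝ × ((ℍ × ℍ) × ℍ) × (Fol L → ℍ))`. [folklore] -/
def jointDeficit (p : TwoScaleParam L) : ℝ := twoScaleDeficit L p.1 p.2.1 p.2.2.1 p.2.2.2.1 p.2.2.2.2

/-- The joint deficit is `C^∞` on `ℝ × ℝ × sliceGood`. [folklore] -/
theorem contDiffOn_jointDeficit : ContDiffOn ℝ ∞ (jointDeficit L) {p : TwoScaleParam L | p.2.2 ∈ sliceGood L} := by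
  refine (contDiffOn_twoScaleDeficit (L := L) (n := ⊤)).mono fun p hp => ?_
  obtain ⟨⟨⟨⟨ha, hx⟩, hy'⟩, hz⟩, hf⟩ := hp
  exact mem_twoScaleGood_of_re_ne hx hy' hz ha fun i => (Set.mem_iInter.1 hf i)

variable (L) in
/-- ★ **The two-scale structure function** `Φ(u, s; a₀, w', y) := twoScaleRemainder (G(·, ·; a₀, w', y)) u s`. [folklore] -/
def twoScalePhi (u s a₀ : ℝ) (w' : (ℍ × ℍ) × ℍ) (y : Fol L → ℍ) : ℝ :=
  twoScaleRemainder (fun q : ℝ × ℝ => twoScaleDeficit L q.1 q.2 a₀ w' y) u s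

/-- ★★★ **`Φ` IS JOINTLY CONTINUOUS in `(u, s, a₀, w', y)` on `ℝ × ℝ × sliceGood`** (✓`TwoScaleCalculus.continuousOn_twoScaleRemainder_slice`). [folklore] -/
theorem continuousOn_twoScalePhi :
    ContinuousOn (fun p : TwoScaleParam L => twoScalePhi L p.1 p.2.1 p.2.2.1 p.2.2.2.1 p.2.2.2.2) {p | p.2.2 ∈ sliceGood L} := by
  have h := continuousOn_twoScaleRemainder_slice (Y := ℝ × ((ℍ × ℍ) × ℍ) × (Fol L → ℍ)) (f := jointDeficit L) isOpen_sliceGood contDiffOn_jointDeficit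
  refine h.congr fun p _ => ?_
  have hF : (fun q : ℝ × ℝ => jointDeficit L (q.1, q.2, p.2.2)) = fun q : ℝ × ℝ => twoScaleDeficit L q.1 q.2 p.2.2.1 p.2.2.2.1 p.2.2.2.2 := rfl
  show twoScalePhi L p.1 p.2.1 p.2.2.1 p.2.2.2.1 p.2.2.2.2 = twoScaleRemainder (fun q : ℝ × ℝ => jointDeficit L (q.1, q.2, p.2.2)) p.1 p.2.1
  rw [hF]
  rfl

/-- ★★★ **THE STRUCTURE THEOREM, joint form**: on `sliceGood` with positive follower real parts, `G = u⁴ s² Φ` with `Φ` jointly continuous. [cite: Luscher1983, §2] -/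
theorem twoScaleDeficit_eq_pow_four_mul_sq_phi {a₀ : ℝ} {w' : (ℍ × ℍ) × ℍ} {y : Fol L → ℍ} (hx : w'.1.1.re ≠ 0) (hy' : w'.1.2.re ≠ 0) (hz : w'.2.re ≠ 0)
    (ha : a₀ ≠ 0) (hf : ∀ i, 0 < (y i).re) (u s : ℝ) : twoScaleDeficit L u s a₀ w' y = u ^ 4 * s ^ 2 * twoScalePhi L u s a₀ w' y := by
  unfold twoScalePhi
  exact twoScaleDeficit_eq_pow_four_mul_sq hx hy' hz ha hf u s

/-- ★ On the fibre (`u, s ≠ 0`): `G ≤ (u²s)² ⟺ Φ ≤ 1`, in terms of `twoScalePhi`. [folklore] -/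
theorem twoScaleDeficit_le_iff_phi {a₀ : ℝ} {w' : (ℍ × ℍ) × ℍ} {y : Fol L → ℍ} (hx : w'.1.1.re ≠ 0) (hy' : w'.1.2.re ≠ 0) (hz : w'.2.re ≠ 0)
    (ha : a₀ ≠ 0) (hf : ∀ i, 0 < (y i).re) {u s : ℝ} (hu : u ≠ 0) (hs : s ≠ 0) :
    twoScaleDeficit L u s a₀ w' y ≤ (u ^ 2 * s) ^ 2 ↔ twoScalePhi L u s a₀ w' y ≤ 1 := by
  unfold twoScalePhi
  exact twoScaleDeficit_le_iff hx hy' hz ha hf hu hs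

/-- ★★ **THE POINTWISE TWO-SCALE LIMIT OF THE FIBRE CONDITION, hub moving**: at a non-degenerate point whose limit value `Φ(0,0;a₀,w',y) ≠ 1`, as
`(u, s, a') → (0, 0, a₀)` with `u, s ≠ 0`, the condition `G(u, s; a', w', y) ≤ (u²s)²` is eventually equivalent to `Φ(0, 0; a₀, w', y) < 1`
(the periodic analogue of ✓`BlowUp.eventually_mem_iff_blowUpLimit`). [folklore] -/
theorem eventually_twoScaleDeficit_le_iff {a₀ : ℝ} {w' : (ℍ × ℍ) × ℍ} {y : Fol L → ℍ} (hx : w'.1.1.re ≠ 0) (hy' : w'.1.2.re ≠ 0) (hz : w'.2.re ≠ 0)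
    (ha : a₀ ≠ 0) (hf : ∀ i, 0 < (y i).re) (hne : twoScalePhi L 0 0 a₀ w' y ≠ 1) :
    ∀ᶠ q : (ℝ × ℝ) × ℝ in 𝓝[{q | q.1.1 ≠ 0 ∧ q.1.2 ≠ 0}] (((0 : ℝ), (0 : ℝ)), a₀),
      (twoScaleDeficit L q.1.1 q.1.2 q.2 w' y ≤ (q.1.1 ^ 2 * q.1.2) ^ 2 ↔ twoScalePhi L 0 0 a₀ w' y < 1) := by
  -- continuity of `Φ` along `q ↦ (q.1.1, q.1.2, q.2, w', y)` at the base point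
  have hmem : (((0 : ℝ), (0 : ℝ), a₀, w', y) : TwoScaleParam L) ∈ {p : TwoScaleParam L | p.2.2 ∈ sliceGood L} :=
    mem_sliceGood ha hx hy' hz fun i => (hf i).ne'
  have hopen : IsOpen {p : TwoScaleParam L | p.2.2 ∈ sliceGood L} := isOpen_planeProd isOpen_sliceGood
  have hcont : ContinuousAt (fun p : TwoScaleParam L => twoScalePhi L p.1 p.2.1 p.2.2.1 p.2.2.2.1 p.2.2.2.2) ((0 : ℝ), (0 : ℝ), a₀, w', y) :=
    continuousOn_twoScalePhi.continuousAt (hopen.mem_nhds hmem)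
  have hι : Continuous fun q : (ℝ × ℝ) × ℝ => ((q.1.1, q.1.2, q.2, w', y) : TwoScaleParam L) :=
    (continuous_fst.comp continuous_fst).prodMk ((continuous_snd.comp continuous_fst).prodMk (continuous_snd.prodMk continuous_const))
  have key : ContinuousAt (fun q : (ℝ × ℝ) × ℝ => twoScalePhi L q.1.1 q.1.2 q.2 w' y) (((0 : ℝ), (0 : ℝ)), a₀) := by
    have e : (fun q : (ℝ × ℝ) × ℝ => twoScalePhi L q.1.1 q.1.2 q.2 w' y) =
        (fun p : TwoScaleParam L => twoScalePhi L p.1 p.2.1 p.2.2.1 p.2.2.2.1 p.2.2.2.2) ∘ (fun q : (ℝ × ℝ) × ℝ => ((q.1.1, q.1.2, q.2, w', y) : TwoScaleParam L)) := rfl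
    rw [e]
    exact ContinuousAt.comp hcont hι.continuousAt
  have hΦ : Tendsto (fun q : (ℝ × ℝ) × ℝ => twoScalePhi L q.1.1 q.1.2 q.2 w' y) (𝓝 (((0 : ℝ), (0 : ℝ)), a₀)) (𝓝 (twoScalePhi L 0 0 a₀ w' y)) :=
    key.tendsto
  -- near `a₀ ≠ 0` the moving hub stays non-degenerate
  have ha' : ∀ᶠ q : (ℝ × ℝ) × ℝ in 𝓝 (((0 : ℝ), (0 : ℝ)), a₀), q.2 ≠ 0 :=
    (continuous_snd.continuousAt (x := (((0 : ℝ), (0 : ℝ)), a₀))).eventually_ne ha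
  rcases lt_or_gt_of_ne hne with hlt | hgt
  · have hev : ∀ᶠ q : (ℝ × ℝ) × ℝ in 𝓝 (((0 : ℝ), (0 : ℝ)), a₀), twoScalePhi L q.1.1 q.1.2 q.2 w' y < 1 := hΦ (Iio_mem_nhds hlt)
    filter_upwards [mem_nhdsWithin_of_mem_nhds hev, mem_nhdsWithin_of_mem_nhds ha', self_mem_nhdsWithin] with q hq hqa hq0
    rw [twoScaleDeficit_le_iff_phi hx hy' hz hqa hf hq0.1 hq0.2]
    exact ⟨fun _ => hlt, fun _ => hq.le⟩
  · have hev : ∀ᶠ q : (ℝ × ℝ) × ℝ in 𝓝 (((0 : ℝ), (0 : ℝ)), a₀), 1 < twoScalePhi L q.1.1 q.1.2 q.2 w' y := hΦ (Ioi_mem_nhds hgt)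
    filter_upwards [mem_nhdsWithin_of_mem_nhds hev, mem_nhdsWithin_of_mem_nhds ha', self_mem_nhdsWithin] with q hq hqa hq0
    rw [twoScaleDeficit_le_iff_phi hx hy' hz hqa hf hq0.1 hq0.2]
    exact ⟨fun h => absurd (lt_of_lt_of_le hq h) (lt_irrefl _), fun h => absurd (h.trans hgt) (lt_irrefl _)⟩

end Joint

end Summit.QuantumFields.YangMills.Theorems.SwapVirialDeficit.BlowUpRing

end
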